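import Literature.AnabelianGeometry.SemiGraphs.PSCMultiVertexCriteria
import Literature.AnabelianGeometry.SemiGraphs.ProSigmaFreeFactorDisjoint
import Literature.AnabelianGeometry.SemiGraphs.ProSigmaCompletionRestrict
import Literature.AnabelianGeometry.SemiGraphs.ProSigmaCompletionExtend
import Literature.AnabelianGeometry.SemiGraphs.SurfaceTypeCoveringsToolkit
import Literature.AnabelianGeometry.SemiGraphs.ProSigmaCuspInertiaMalnormalHolds
import Literature.GroupTheory.CombinatorialGroupTheory.FreeGroupCyclicKernelBasis
import Literature.GroupTheory.CombinatorialGroupTheory.PuncturedSurfaceGroupNodeLoopBasis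
import HarnessLib

/-!
# [CombGC] Prop. 1.2 (ii), verticial/edge-like clause, at IRREDUCIBLE ONE-NODAL data: free factors at a cyclic level

Mochizuki, *A combinatorial version of the Grothendieck conjecture*, Tohoku Math. J. **59** (2007)
[CombGC] §1, Proposition 1.2 (ii) p. 8: "the `Aᵢ` [verticial and edge-like subgroups] are commensurably
terminal in `Π_G`" [cite: MochizukiCombGC2007, Prop 1.2(ii) p.8].  Typed by abc-iut-L3-t4 as
`PSCDatum.VerticialEdgeLikeCommensurablyTerminal` (first clause of abc-iut FACT-LIST row F-0438
`PSCDatum.CommensurableTerminalityHolds Ω`; the universal closure over the abstract origin parameter is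
refuted, instance forms at genuine carriers are the content).

PROOF-ONLY file (abc-iut-w5-d174 gen 6).  THE CARRIER: the data of IRREDUCIBLE ONE-NODAL shape of
abc-iut-f-164 (`PSCIrreducibleNodalShape.lean` / `…Origin.lean`; stratum `Δ_irr`): an irreducible pointed
stable curve with ONE node and `r + 1 ≥ 1` marked points, `Π` a profinite pro-`Σ` completion
`ι : Γ_{g,r+1} → Π` of the smoothing (`g ≥ 1`), node group `Π_ν = cl ι⟨b_0⟩`, cusp groups `cl ι⟨c_j⟩`, and
the single vertex group `Π_v = cl ι⟨b_0, a_0 b_0 a_0⁻¹, a_i, b_i (i ≥ 1), c_j⟩` (the surface cut open along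
`b_0`; `a_0` the stable letter).  Every earlier instance of this clause in the tree (smooth curves,
two-component affine/pointed data, three-component chains: abc-iut-w5-d195, f-164, f-166) has vertex groups
that are closures of FREE FACTORS of `Γ`; here `A_v = ⟨b_0, a_0 b_0 a_0⁻¹, a_i, b_i (i ≥ 1), c_j⟩` is NOT a
free factor of `Γ_{g,r+1}` (it has the rank of `Γ` and infinite index: the vertex group of the
HNN-splitting along the loop of the dual graph) — abc-iut-f-164's `PSCUnrVerticialSeparatingCoveringsIrreducibleNodal.lean`
records exactly this clause as its honest scope limit.

## The mechanism: a free factor OF A CYCLIC LEVEL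

For `m ≥ 2` the group `A_v` IS the closure-free part of a sub-basis of the Schreier basis of the cyclic
kernel `K_m = Ker(Γ → ℤ/m, a_0 ↦ 1, other letters ↦ 0)` (`FreeGroupCyclicKernelBasis.lean`:
`{a_0^j x a_0^{-j}} ∪ {a_0^m}`; `a_0 b_0 a_0⁻¹` is the member `(b_0, 1)`).  Hence, with `ℓ ∈ Σ` and the
open normal levels `V_ℓ ⊇ V_{ℓ²}` of `Π` extending `K_ℓ ⊇ K_{ℓ²}` (continuous extensions of the two
characters, `ProSigmaCompletionExtend.lean`), `Π_v ≤ V_{ℓ²}` is the closure of a free factor of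
`K_ℓ = ι⁻¹(V_ℓ)` along the pro-`Σ` completion `ι| : K_ℓ → V_ℓ` (`ProSigmaCompletionRestrict.lean`), so it is
MALNORMAL IN `V_ℓ` (abc-iut-L5-t6's `freeFactor_inf_conj_eq_bot`, Ribes–Zalesskii 9.1.12); and an element
`x` of the commensurator outside `V_ℓ` is impossible: `x^ℓ ∈ C_Π(Π_v) ∩ V_ℓ = Π_v ≤ V_{ℓ²}` forces the
`a_0`-exponent class of `x` in `ℤ/ℓ²` to be killed by `ℓ`, i.e. `x ∈ V_ℓ`.

* `IsProSigmaCompletion.isCommensurablyTerminal_of_freeFactor_at_cyclicLevel` — the ENGINE, for any free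
  basis, letter `t`, prime `ℓ ∈ Σ`, and any `A ≤ K_{ℓ²}` that is a sub-basis closure of some free basis of
  `K_ℓ`;
* `PSCDatum.verticialEdgeLikeCommensurablyTerminal_of_irreducibleNodal_affine` — **F-0438, first clause, at
  EVERY irreducible one-nodal datum with `r + 1 ≥ 1` cusps** (vertex group by the engine, node group
  `cl ι⟨b_0⟩` = a rank-one free factor of `Γ`, cusp groups by abc-iut-L3-t4's cusp-inertia theorem), fed into
  abc-iut-L5-t6's criterion `verticialEdgeLikeCommensurablyTerminal_of`.

HONEST SCOPE: affine data (`r + 1 ≥ 1`, `Γ` free); the proper irreducible nodal curve (`Γ_{g,0}`) and the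
`Π^unr`-clause (abc-iut-f-164, done) are not treated here.  A shape instance is consistency evidence for
the typed schema, not the printed theorem for all pointed stable curves (cell FOUNDATIONS rows 13–14).
0 definitions; nothing here takes a side on [IUTchIII] Cor. 3.12.
-/

noncomputable section

open scoped Pointwise

namespace Literature.AnabelianGeometry.SemiGraphs

open Literature.AnabelianGeometry.Anabelioids (IsSigmaInteger)
open Literature.GroupTheory.CombinatorialGroupTheory
open Multiplicative Topology

universe u v

/-! ### Group-theoretic bookkeeping -/

section Bookkeeping

variable {P : Type v} [Group P]

/-- Evaluation of the homomorphism determined by a free basis on a basis element. [folklore] -/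
private theorem lift_apply_basis₄ {Γ : Type*} [Group Γ] {β H : Type*} [Group H] (b : FreeGroupBasis β Γ)
    (f : β → H) (i : β) : b.lift f (b i) = f i := by
  change FreeGroup.lift f (b.repr (b i)) = f i
  rw [FreeGroupBasis.repr_apply_coe, FreeGroup.lift_apply_of]

/-- `f (a H a⁻¹) = f(a) f(H) f(a)⁻¹` (private copy of abc-iut-f-166's lemma). [folklore] -/
private theorem map_toConjAct_smul'' {Γ : Type*} [Group Γ] (f : Γ →* P) (a : Γ) (H : Subgroup Γ) :
    (ConjAct.toConjAct a • H).map f = ConjAct.toConjAct (f a) • H.map f := by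
  rw [← map_conj_eq_conjAct_smul, ← map_conj_eq_conjAct_smul, Subgroup.map_map, Subgroup.map_map]
  congr 1
  ext x
  simp [MulAut.conj_apply]

/-- **A commensurator element meets `A` non-trivially** when `A` is infinite: `A ∩ xAx⁻¹` has finite index
in `A`, so it is not trivial (the core of abc-iut-L5-t6's `isCommensurablyTerminal_of_inf_conj_eq_bot`).
[cite: RibesZalesskii2010, Thm. 9.1.12] -/
theorem inf_conjAct_smul_ne_bot_of_mem_commensurator {A : Subgroup P} [Infinite A] {x : P}
    (hx : x ∈ Subgroup.Commensurable.commensurator A) : A ⊓ ConjAct.toConjAct x • A ≠ ⊥ := by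
  intro hbot
  have hcomm : Subgroup.Commensurable (ConjAct.toConjAct x • A) A :=
    (Subgroup.Commensurable.commensurator_mem_iff A x).mp hx
  haveI hfi : ((ConjAct.toConjAct x • A).subgroupOf A).FiniteIndex := ⟨hcomm.1⟩
  have hne1 : ((ConjAct.toConjAct x • A).subgroupOf A) ≠ ⊥ := by
    intro hb
    have hidx := Subgroup.index_bot (G := A)
    rw [← hb] at hidx
    have := ((ConjAct.toConjAct x • A).subgroupOf A).index_ne_zero_of_finite
    rw [hidx] at this
    exact this Nat.card_eq_zero_of_infinite
  apply hne1
  rw [eq_bot_iff]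
  intro z hz
  have hz' : (z : P) ∈ A ⊓ ConjAct.toConjAct x • A := ⟨z.2, hz⟩
  rw [hbot, Subgroup.mem_bot] at hz'
  exact Subgroup.mem_bot.mpr (Subtype.ext hz')

/-- In `ℤ/ℓ²`: an element killed by `ℓ` reduces to `0` mod `ℓ`. [folklore] -/
private theorem zmod_castHom_eq_zero_of_nsmul_eq_zero {ℓ : ℕ} (hℓ : ℓ.Prime) [NeZero (ℓ ^ 2)] (z : ZMod (ℓ ^ 2))
    (hz : ℓ • z = 0) : ZMod.castHom (dvd_pow_self ℓ two_ne_zero) (ZMod ℓ) z = 0 := by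
  obtain ⟨k, rfl⟩ := ZMod.natCast_zmod_surjective z
  rw [map_natCast, ZMod.natCast_eq_zero_iff]
  rw [nsmul_eq_mul, ← Nat.cast_mul, ZMod.natCast_eq_zero_iff, pow_two] at hz
  exact Nat.dvd_of_mul_dvd_mul_left hℓ.pos hz

end Bookkeeping

/-! ### The engine: a free factor of a cyclic level is commensurably terminal -/

namespace SemiGraphOfAnabelioids.IsProSigmaCompletion

variable {Sigma : Set ℕ} {Γ : Type u} [Group Γ] {P : Type v} [Group P] [TopologicalSpace P]
  [IsTopologicalGroup P] [CompactSpace P] [T2Space P] [TotallyDisconnectedSpace P] {ι : Γ →* P}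

/-- **Free factors of a cyclic level are commensurably terminal.**  Let `ι : Γ → Π` be a profinite pro-`Σ`
completion of a group free on `b : X → Γ`, `t ∈ X`, `ℓ ∈ Σ` prime, `χ₁ : Γ → ℤ/ℓ` and `χ₂ : Γ → ℤ/ℓ²` the
exponent sum of `t` (`b t ↦ 1`, `b x ↦ 0` otherwise).  If `A ≤ Ker χ₂` is generated by a NONEMPTY part of
some free basis of `Ker χ₁`, then `cl ι(A)` is commensurably terminal in `Π`: inside the open normal level
`V_ℓ` (kernel of the continuous extension of `χ₁`) it is the closure of a free factor along the pro-`Σ`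
completion `ι| : Ker χ₁ → V_ℓ`, hence malnormal there (`freeFactor_inf_conj_eq_bot`); a commensurator
element `x ∉ V_ℓ` would have `x^ℓ ∈ C(cl ιA) ∩ V_ℓ = cl ιA ≤ V_{ℓ²}`, i.e. `ℓ · χ̂₂(x) = 0` in `ℤ/ℓ²`,
forcing `χ̂₁(x) = 0`. [cite: MochizukiCombGC2007, Prop 1.2(ii) p.8] [cite: RibesZalesskii2010, Thm. 9.1.12] -/
theorem isCommensurablyTerminal_of_freeFactor_at_cyclicLevel (hι : IsProSigmaCompletion Sigma ι)
    {X : Type u} [DecidableEq X] (b : FreeGroupBasis X Γ) (t₀ : X) {ℓ : ℕ} (hℓ : ℓ.Prime)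
    (hℓS : ℓ ∈ Sigma) (χ₁ : Γ →* Multiplicative (ZMod ℓ))
    (hχ₁ : ∀ x, χ₁ (b x) = if x = t₀ then ofAdd (1 : ZMod ℓ) else 1)
    (χ₂ : Γ →* Multiplicative (ZMod (ℓ ^ 2)))
    (hχ₂ : ∀ x, χ₂ (b x) = if x = t₀ then ofAdd (1 : ZMod (ℓ ^ 2)) else 1)
    (A : Subgroup Γ) (hA₂ : A ≤ χ₂.ker) {κ : Type*} (bK : FreeGroupBasis κ χ₁.ker) (S : Set κ)
    (hS : S.Nonempty) (hA : A = (Subgroup.closure (bK '' S)).map χ₁.ker.subtype) :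
    AbsoluteAnabelian.IsCommensurablyTerminal (A.map ι).topologicalClosure := by
  classical
  haveI : Fact ℓ.Prime := ⟨hℓ⟩
  haveI : NeZero (ℓ ^ 2) := ⟨pow_ne_zero _ hℓ.ne_zero⟩
  letI : TopologicalSpace (Multiplicative (ZMod (ℓ ^ 2))) := ⊥
  haveI : DiscreteTopology (Multiplicative (ZMod (ℓ ^ 2))) := ⟨rfl⟩
  letI : TopologicalSpace (Multiplicative (ZMod ℓ)) := ⊥
  haveI : DiscreteTopology (Multiplicative (ZMod ℓ)) := ⟨rfl⟩
  -- (1) the continuous extension `Χ₂ : Π → ℤ/ℓ²` of `χ₂`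
  have hcard : IsSigmaInteger Sigma (Nat.card (Multiplicative (ZMod (ℓ ^ 2)))) := by
    rw [Nat.card_congr Multiplicative.toAdd, Nat.card_zmod]
    refine ⟨pos_of_ne_zero (NeZero.ne _), fun p hp hdvd => ?_⟩
    rw [(Nat.prime_dvd_prime_iff_eq hp hℓ).mp (hp.dvd_of_dvd_pow hdvd)]
    exact hℓS
  obtain ⟨Χ₂, hΧ₂c, hΧ₂⟩ := exists_continuous_extend_top hι hcard χ₂
  -- (2) reduction mod `ℓ`: `Χ₁ = π ∘ Χ₂` extends `χ₁`
  obtain ⟨π, hπ⟩ : ∃ π : Multiplicative (ZMod (ℓ ^ 2)) →* Multiplicative (ZMod ℓ),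
      ∀ z, π z = ofAdd (ZMod.castHom (dvd_pow_self ℓ two_ne_zero) (ZMod ℓ) (toAdd z)) :=
    ⟨(ZMod.castHom (dvd_pow_self ℓ two_ne_zero) (ZMod ℓ)).toAddMonoidHom.toMultiplicative, fun z => rfl⟩
  have hχ₁π : ∀ γ, χ₁ γ = π (χ₂ γ) := by
    intro γ
    have h : χ₁ = π.comp χ₂ := b.ext_hom _ _ fun x => by
      rw [MonoidHom.comp_apply, hχ₁, hχ₂]
      by_cases hx : x = t₀
      · rw [if_pos hx, if_pos hx, hπ, toAdd_ofAdd, (ZMod.castHom (dvd_pow_self ℓ two_ne_zero) (ZMod ℓ)).map_one]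
      · rw [if_neg hx, if_neg hx, map_one]
    rw [h, MonoidHom.comp_apply]
  obtain ⟨Χ₁, hΧ₁def⟩ : ∃ Χ₁ : P →* Multiplicative (ZMod ℓ), ∀ p, Χ₁ p = π (Χ₂ p) :=
    ⟨π.comp Χ₂, fun p => rfl⟩
  have hΧ₁c : Continuous Χ₁ := by
    have hπc : Continuous π := continuous_of_discreteTopology
    have h : (Χ₁ : P → Multiplicative (ZMod ℓ)) = π ∘ Χ₂ := funext fun p => hΧ₁def p
    rw [h]
    exact hπc.comp hΧ₂c
  have hΧ₁ : ∀ γ, Χ₁ (ι γ) = χ₁ γ := fun γ => by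
    rw [hΧ₁def, hΧ₂, hχ₁π]
  -- (3) the two levels
  set V₁ : Subgroup P := Χ₁.ker with hV₁def
  set V₂ : Subgroup P := Χ₂.ker with hV₂def
  have hV₁o : IsOpen (V₁ : Set P) := by
    rw [hV₁def, MonoidHom.coe_ker]
    exact (isOpen_discrete _).preimage hΧ₁c
  have hV₂c : IsClosed (V₂ : Set P) := by
    rw [hV₂def, MonoidHom.coe_ker]
    exact (isClosed_discrete _).preimage hΧ₂c
  have hV₁K : V₁.comap ι = χ₁.ker := by
    ext γ
    rw [Subgroup.mem_comap, hV₁def, MonoidHom.mem_ker, MonoidHom.mem_ker, hΧ₁]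
  -- (4) `V₁` is the pro-`Σ` completion of `Ker χ₁`
  have hmem : ∀ k : χ₁.ker, (ι.comp χ₁.ker.subtype) k ∈ V₁ := fun k => by
    show Χ₁ (ι (k : Γ)) = 1
    rw [hΧ₁]
    exact k.2
  set ι₁ : χ₁.ker →* V₁ := (ι.comp χ₁.ker.subtype).codRestrict V₁ hmem with hι₁def
  have hι₁ : IsProSigmaCompletion Sigma ι₁ :=
    restrict_comp_of_range_eq hι V₁ hV₁o χ₁.ker.subtype Subtype.coe_injective
      (by rw [Subgroup.range_subtype, hV₁K]) hmem
  haveI : CompactSpace V₁ := isCompact_iff_compactSpace.mp (V₁.isClosed_of_isOpen hV₁o).isCompact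
  -- (5) the free factor inside `V₁`
  set A' : Subgroup V₁ := ((Subgroup.closure (bK '' S)).map ι₁).topologicalClosure with hA'def
  haveI : Infinite A' := infinite_freeFactor bK S hS hι₁ ⟨ℓ, hℓS, hℓ⟩
  have hmal : ∀ y : V₁, y ∉ A' → A' ⊓ ConjAct.toConjAct y • A' = ⊥ := fun y hy =>
    freeFactor_inf_conj_eq_bot bK S hι₁ hy
  -- (6) identification `cl ι(A) = A'` (pushed into `Π`)
  set Av : Subgroup P := (A.map ι).topologicalClosure with hAvdef
  have hembed : IsClosedEmbedding (V₁.subtype : V₁ → P) :=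
    (V₁.isClosed_of_isOpen hV₁o).isClosedEmbedding_subtypeVal
  have hcomp : V₁.subtype.comp ι₁ = ι.comp χ₁.ker.subtype := MonoidHom.ext fun k => rfl
  have hAv : Av = A'.map V₁.subtype := by
    rw [hA'def, ← topologicalClosure_map_of_isClosedEmbedding V₁.subtype hembed, Subgroup.map_map, hcomp,
      ← Subgroup.map_map, ← hA]
  have hmemA : ∀ y : V₁, (y : P) ∈ Av ↔ y ∈ A' := fun y => by
    rw [hAv]
    exact Subgroup.mem_map_iff_mem Subtype.coe_injective
  haveI : Infinite Av := by
    rw [hAv]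
    exact (Equiv.infinite_iff (A'.equivMapOfInjective V₁.subtype Subtype.coe_injective).toEquiv).mp
      inferInstance
  have hAvV₂ : Av ≤ V₂ := by
    refine Subgroup.topologicalClosure_minimal _ ?_ hV₂c
    rintro _ ⟨a, ha, rfl⟩
    rw [hV₂def, MonoidHom.mem_ker, hΧ₂]
    exact hA₂ ha
  -- (7) commensurator elements inside `V₁` lie in `Av` (malnormality in `V₁`)
  have step1 : ∀ y : P, y ∈ Subgroup.Commensurable.commensurator Av → y ∈ V₁ → y ∈ Av := by
    intro y hy hyV
    by_contra hyA
    have hy' : (⟨y, hyV⟩ : V₁) ∉ A' := fun h => hyA ((hmemA ⟨y, hyV⟩).mpr h)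
    have hbot := hmal ⟨y, hyV⟩ hy'
    apply inf_conjAct_smul_ne_bot_of_mem_commensurator hy
    have hmap := congrArg (Subgroup.map V₁.subtype) hbot
    rw [Subgroup.map_inf_eq _ _ V₁.subtype Subtype.coe_injective, map_toConjAct_smul'', Subgroup.map_bot,
      ← hAv] at hmap
    exact hmap
  -- (8) every commensurator element lies in `V₁`
  have step2 : ∀ x : P, x ∈ Subgroup.Commensurable.commensurator Av → x ∈ V₁ := by
    intro x hx
    have hxℓV₁ : x ^ ℓ ∈ V₁ := by
      rw [hV₁def, MonoidHom.mem_ker, map_pow, ← ofAdd_toAdd (Χ₁ x), ← ofAdd_nsmul, nsmul_eq_mul,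
        ZMod.natCast_self, zero_mul, ofAdd_zero]
    have hxℓ : x ^ ℓ ∈ Av := step1 (x ^ ℓ) (Subgroup.pow_mem _ hx ℓ) hxℓV₁
    have hxℓV₂ : Χ₂ (x ^ ℓ) = 1 := hAvV₂ hxℓ
    rw [map_pow, ← ofAdd_toAdd (Χ₂ x), ← ofAdd_nsmul, ofAdd_eq_one] at hxℓV₂
    rw [hV₁def, MonoidHom.mem_ker, hΧ₁def, hπ, zmod_castHom_eq_zero_of_nsmul_eq_zero hℓ (toAdd (Χ₂ x)) hxℓV₂,
      ofAdd_zero]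
  exact ⟨le_antisymm (fun x hx => step1 x hx (step2 x hx)) (le_commensurator_self Av)⟩

end SemiGraphOfAnabelioids.IsProSigmaCompletion

/-! ### The instance: irreducible one-nodal data with cusps -/

namespace PSCDatum

open Literature.GroupTheory.CombinatorialGroupTheory.PuncturedSurfaceGroup (a b c cuspInertia
  exists_freeGroupBasis_elim_zero c_zero_eq ofFree ofFree_of_inl ofFree_of_inr commProd cuspProd)
open SemiGraphOfAnabelioids (IsProSigmaCompletion cuspInertia_closure_isCommensurablyTerminal)
open SemiGraphOfAnabelioids.IsProSigmaCompletion (freeFactor_isCommensurablyTerminal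
  isCommensurablyTerminal_of_freeFactor_at_cyclicLevel)

variable {P : Type} [Group P] [TopologicalSpace P] [IsTopologicalGroup P]
variable [CompactSpace P] [T2Space P] [TotallyDisconnectedSpace P] {Sigma : Set ℕ} {g r : ℕ}

/-- **The discrete vertex group lies in the kernel of the `a_0`-exponent sum.**  Every generator of
`A_v = ⟨b_0, a_0 b_0 a_0⁻¹, a_i, b_i (i ≥ 1), c_j⟩` has `a_0`-exponent sum zero — for `c_0 = (∏[a_i,b_i] ∏_{j≥1}
c_j)⁻¹` because the target is commutative. [cite: MochizukiCombGC2007, Def 1.1(ii) p.6] -/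
theorem irreducibleNodal_vertexGenerators_le_ker (hg : 1 ≤ g) {M : Type*} [CommGroup M]
    (χ : PuncturedSurfaceGroup g (r + 1) →* M) (hb : ∀ i, χ (b i) = 1)
    (ha : ∀ i : Fin g, 1 ≤ (i : ℕ) → χ (a i) = 1) (hc : ∀ j : Fin r, χ (c (Fin.succ j)) = 1) :
    Subgroup.closure {x : PuncturedSurfaceGroup g (r + 1) |
        x = b ⟨0, hg⟩ ∨ x = a ⟨0, hg⟩ * b ⟨0, hg⟩ * (a ⟨0, hg⟩)⁻¹ ∨
        (∃ i : Fin g, 1 ≤ (i : ℕ) ∧ (x = a i ∨ x = b i)) ∨ ∃ j : Fin (r + 1), x = c j} ≤ χ.ker := by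
  have hc0 : χ (c 0) = 1 := by
    have hcomm : χ (ofFree g r (commProd g r)) = 1 := by
      simp only [commProd, map_list_prod, List.map_map]
      refine List.prod_eq_one fun x hx => ?_
      obtain ⟨i, -, rfl⟩ := List.mem_map.mp hx
      simp only [Function.comp_apply, map_mul, map_inv, ofFree_of_inl]
      change χ (a i) * χ (b i) * (χ (a i))⁻¹ * (χ (b i))⁻¹ = 1
      rw [hb i, mul_one, inv_one, mul_one, mul_inv_cancel]
    have hcusp : χ (ofFree g r (cuspProd g r)) = 1 := by
      simp only [cuspProd, map_list_prod, List.map_map]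
      refine List.prod_eq_one fun x hx => ?_
      obtain ⟨j, -, rfl⟩ := List.mem_map.mp hx
      simp only [Function.comp_apply, ofFree_of_inr]
      exact hc j
    rw [c_zero_eq, map_mul, map_inv, map_inv, hcomm, hcusp, inv_one, mul_one]
  rw [Subgroup.closure_le]
  rintro x (rfl | rfl | ⟨i, hi, rfl | rfl⟩ | ⟨j, rfl⟩)
  · exact hb _
  · rw [SetLike.mem_coe, MonoidHom.mem_ker, map_mul, map_mul, map_inv, hb, mul_one, mul_inv_cancel]
  · exact ha i hi
  · exact hb i
  · rw [SetLike.mem_coe, MonoidHom.mem_ker]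
    refine Fin.cases hc0 (fun j' => hc j') j

/-- **The discrete vertex group in the letters of the `c_0`-eliminating basis.**  With `b₀` the free basis
`a_i, b_i, c_{j+1}` of `Γ_{g,r+1}`: `⟨b_0, a_0 b_0 a_0⁻¹, a_i, b_i (i≥1), c_j⟩ = ⟨b₀ x (x ≠ a_0), a_0 b_0 a_0⁻¹⟩`
(the only non-member, `c_0`, is a word in the others). [cite: MochizukiCombGC2007, Def 1.1(ii) p.6] -/
theorem irreducibleNodal_vertexClosure_eq (hg : 1 ≤ g)
    (b₀ : FreeGroupBasis ((Fin g × Bool) ⊕ Fin r) (PuncturedSurfaceGroup g (r + 1)))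
    (hba : ∀ i, b₀ (Sum.inl (i, false)) = a i) (hbb : ∀ i, b₀ (Sum.inl (i, true)) = b i)
    (hbc : ∀ j : Fin r, b₀ (Sum.inr j) = c (Fin.succ j)) :
    Subgroup.closure {x : PuncturedSurfaceGroup g (r + 1) |
        x = b ⟨0, hg⟩ ∨ x = a ⟨0, hg⟩ * b ⟨0, hg⟩ * (a ⟨0, hg⟩)⁻¹ ∨
        (∃ i : Fin g, 1 ≤ (i : ℕ) ∧ (x = a i ∨ x = b i)) ∨ ∃ j : Fin (r + 1), x = c j} =
      Subgroup.closure ({x : PuncturedSurfaceGroup g (r + 1) |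
          ∃ y : (Fin g × Bool) ⊕ Fin r, y ≠ Sum.inl (⟨0, hg⟩, false) ∧ x = b₀ y} ∪
        {b₀ (Sum.inl (⟨0, hg⟩, false)) * b₀ (Sum.inl (⟨0, hg⟩, true)) *
          (b₀ (Sum.inl (⟨0, hg⟩, false)))⁻¹}) := by
  set R : Subgroup (PuncturedSurfaceGroup g (r + 1)) :=
    Subgroup.closure ({x : PuncturedSurfaceGroup g (r + 1) |
        ∃ y : (Fin g × Bool) ⊕ Fin r, y ≠ Sum.inl (⟨0, hg⟩, false) ∧ x = b₀ y} ∪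
      {b₀ (Sum.inl (⟨0, hg⟩, false)) * b₀ (Sum.inl (⟨0, hg⟩, true)) *
        (b₀ (Sum.inl (⟨0, hg⟩, false)))⁻¹}) with hR
  have hmem : ∀ y : (Fin g × Bool) ⊕ Fin r, y ≠ Sum.inl (⟨0, hg⟩, false) → b₀ y ∈ R :=
    fun y hy => Subgroup.subset_closure (Or.inl ⟨y, hy, rfl⟩)
  have hbR : ∀ i, b i ∈ R := fun i => by
    rw [← hbb]; exact hmem _ (by simp)
  have haR : ∀ i : Fin g, 1 ≤ (i : ℕ) → a i ∈ R := fun i hi => by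
    rw [← hba]
    refine hmem _ fun h => ?_
    have := congrArg (fun y : (Fin g × Bool) ⊕ Fin r => Sum.elim (fun p => (p.1 : ℕ)) (fun _ => 0) y) h
    simp at this
    omega
  have hconjR : a ⟨0, hg⟩ * b ⟨0, hg⟩ * (a ⟨0, hg⟩)⁻¹ ∈ R := by
    rw [← hba, ← hbb]; exact Subgroup.subset_closure (Or.inr rfl)
  have hcR : ∀ j : Fin r, c (Fin.succ j) ∈ R := fun j => by
    rw [← hbc]; exact hmem _ (by simp)
  have hcommR : ∀ i : Fin g, a i * b i * (a i)⁻¹ * (b i)⁻¹ ∈ R := by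
    intro i
    by_cases hi : 1 ≤ (i : ℕ)
    · exact R.mul_mem (R.mul_mem (R.mul_mem (haR i hi) (hbR i)) (R.inv_mem (haR i hi)))
        (R.inv_mem (hbR i))
    · have hi0 : i = ⟨0, hg⟩ := Fin.ext (by simp only [not_le, Nat.lt_one_iff] at hi; exact hi)
      subst hi0
      exact R.mul_mem hconjR (R.inv_mem (hbR _))
  have hc0R : c 0 ∈ R := by
    rw [c_zero_eq]
    refine R.mul_mem (R.inv_mem ?_) (R.inv_mem ?_)
    · simp only [commProd, map_list_prod, List.map_map]
      refine Subgroup.list_prod_mem _ fun x hx => ?_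
      obtain ⟨i, -, rfl⟩ := List.mem_map.mp hx
      simp only [Function.comp_apply, map_mul, map_inv, ofFree_of_inl]
      exact hcommR i
    · simp only [cuspProd, map_list_prod, List.map_map]
      refine Subgroup.list_prod_mem _ fun x hx => ?_
      obtain ⟨j, -, rfl⟩ := List.mem_map.mp hx
      simp only [Function.comp_apply, ofFree_of_inr]
      exact hcR j
  apply le_antisymm
  · rw [Subgroup.closure_le]
    rintro x (rfl | rfl | ⟨i, hi, rfl | rfl⟩ | ⟨j, rfl⟩)
    · exact hbR _
    · exact hconjR
    · exact haR i hi
    · exact hbR i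
    · exact Fin.cases hc0R (fun j' => hcR j') j
  · rw [hR, Subgroup.closure_le]
    rintro x (⟨y, hy, rfl⟩ | rfl)
    · rcases y with ⟨i, _ | _⟩ | j
      · rw [SetLike.mem_coe, hba]
        refine Subgroup.subset_closure (Or.inr (Or.inr (Or.inl ⟨i, ?_, Or.inl rfl⟩)))
        rw [Nat.one_le_iff_ne_zero]
        intro hi0
        exact hy (by rw [show i = ⟨0, hg⟩ from Fin.ext hi0])
      · rw [SetLike.mem_coe, hbb]
        by_cases hi : 1 ≤ (i : ℕ)
        · exact Subgroup.subset_closure (Or.inr (Or.inr (Or.inl ⟨i, hi, Or.inr rfl⟩)))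
        · have hi0 : i = ⟨0, hg⟩ := Fin.ext (by simp only [not_le, Nat.lt_one_iff] at hi; exact hi)
          subst hi0
          exact Subgroup.subset_closure (Or.inl rfl)
      · rw [SetLike.mem_coe, hbc]
        exact Subgroup.subset_closure (Or.inr (Or.inr (Or.inr ⟨Fin.succ j, rfl⟩)))
    · rw [SetLike.mem_coe, hba, hbb]
      exact Subgroup.subset_closure (Or.inr (Or.inl rfl))

/-- **The vertex group of an irreducible one-nodal datum with cusps is commensurably terminal**: for
`ι : Γ_{g,r+1} → Π` a profinite pro-`Σ` completion (`g ≥ 1`, `Σ` nonempty primes), the closed subgroup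
`cl ι⟨b_0, a_0 b_0 a_0⁻¹, a_i, b_i (i ≥ 1), c_j⟩` equals its commensurator — by the engine at the letter `a_0`:
it is the closure of a free factor of the level `Ker(a_0-exponent mod ℓ)`, `ℓ ∈ Σ`.
[cite: MochizukiCombGC2007, Prop 1.2(ii) p.8] -/
theorem isCommensurablyTerminal_vertGp_of_irreducibleNodal_affine (hne : Sigma.Nonempty)
    (hprime : ∀ p ∈ Sigma, p.Prime) (ι : PuncturedSurfaceGroup g (r + 1) →* P)
    (hι : IsProSigmaCompletion Sigma ι) (hg : 1 ≤ g) :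
    AbsoluteAnabelian.IsCommensurablyTerminal
      ((Subgroup.closure {x : PuncturedSurfaceGroup g (r + 1) |
        x = b ⟨0, hg⟩ ∨ x = a ⟨0, hg⟩ * b ⟨0, hg⟩ * (a ⟨0, hg⟩)⁻¹ ∨
        (∃ i : Fin g, 1 ≤ (i : ℕ) ∧ (x = a i ∨ x = b i)) ∨ ∃ j : Fin (r + 1), x = c j}).map
          ι).topologicalClosure := by
  classical
  obtain ⟨ℓ, hℓS⟩ := hne
  have hℓ : ℓ.Prime := hprime ℓ hℓS
  haveI : Fact ℓ.Prime := ⟨hℓ⟩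
  haveI : NeZero (ℓ ^ 2) := ⟨pow_ne_zero _ hℓ.ne_zero⟩
  have hℓ2 : 2 ≤ ℓ := hℓ.two_le
  obtain ⟨b₀, hba, hbb, hbc⟩ := exists_freeGroupBasis_elim_zero g r
  set t₀ : (Fin g × Bool) ⊕ Fin r := Sum.inl (⟨0, hg⟩, false) with ht₀
  -- the two exponent-sum characters
  let χ₁ : PuncturedSurfaceGroup g (r + 1) →* Multiplicative (ZMod ℓ) :=
    b₀.lift fun y => if y = t₀ then ofAdd (1 : ZMod ℓ) else 1
  have hχ₁ : ∀ y, χ₁ (b₀ y) = if y = t₀ then ofAdd (1 : ZMod ℓ) else 1 :=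
    fun y => lift_apply_basis₄ b₀ _ y
  let χ₂ : PuncturedSurfaceGroup g (r + 1) →* Multiplicative (ZMod (ℓ ^ 2)) :=
    b₀.lift fun y => if y = t₀ then ofAdd (1 : ZMod (ℓ ^ 2)) else 1
  have hχ₂ : ∀ y, χ₂ (b₀ y) = if y = t₀ then ofAdd (1 : ZMod (ℓ ^ 2)) else 1 :=
    fun y => lift_apply_basis₄ b₀ _ y
  -- the Schreier basis of `Ker χ₁` and the sub-basis form of the vertex group
  obtain ⟨bK, hbK, -⟩ := b₀.exists_freeGroupBasis_cyclicKernel t₀ ℓ χ₁ hχ₁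
  have hx₀ : (Sum.inl (⟨0, hg⟩, true) : (Fin g × Bool) ⊕ Fin r) ≠ t₀ := by simp [ht₀]
  set S : Set (({x : (Fin g × Bool) ⊕ Fin r // x ≠ t₀} × ZMod ℓ) ⊕ Unit) :=
    (Set.range fun x : {x : (Fin g × Bool) ⊕ Fin r // x ≠ t₀} => Sum.inl (x, (0 : ZMod ℓ))) ∪
      {Sum.inl (⟨Sum.inl (⟨0, hg⟩, true), hx₀⟩, (1 : ZMod ℓ))} with hSdef
  have hS : S.Nonempty := ⟨_, Or.inr rfl⟩
  have hA : Subgroup.closure {x : PuncturedSurfaceGroup g (r + 1) |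
      x = b ⟨0, hg⟩ ∨ x = a ⟨0, hg⟩ * b ⟨0, hg⟩ * (a ⟨0, hg⟩)⁻¹ ∨
      (∃ i : Fin g, 1 ≤ (i : ℕ) ∧ (x = a i ∨ x = b i)) ∨ ∃ j : Fin (r + 1), x = c j} =
      (Subgroup.closure (bK '' S)).map χ₁.ker.subtype := by
    rw [irreducibleNodal_vertexClosure_eq hg b₀ hba hbb hbc, hSdef,
      ← b₀.closure_hnnVertex_eq_map_closure_image t₀ ℓ hℓ2 χ₁ bK hbK ⟨Sum.inl (⟨0, hg⟩, true), hx₀⟩]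
  have hA₂ : Subgroup.closure {x : PuncturedSurfaceGroup g (r + 1) |
      x = b ⟨0, hg⟩ ∨ x = a ⟨0, hg⟩ * b ⟨0, hg⟩ * (a ⟨0, hg⟩)⁻¹ ∨
      (∃ i : Fin g, 1 ≤ (i : ℕ) ∧ (x = a i ∨ x = b i)) ∨ ∃ j : Fin (r + 1), x = c j} ≤ χ₂.ker := by
    refine irreducibleNodal_vertexGenerators_le_ker hg χ₂ (fun i => ?_) (fun i hi => ?_) fun j => ?_
    · rw [← hbb, hχ₂, if_neg]
      rw [ht₀]
      simp
    · rw [← hba, hχ₂, if_neg]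
      rw [ht₀]
      simp only [Sum.inl.injEq, Prod.mk.injEq, and_true]
      intro h
      rw [h] at hi
      exact Nat.not_succ_le_zero 0 hi
    · rw [← hbc, hχ₂, if_neg]
      rw [ht₀]
      exact Sum.inr_ne_inl
  exact isCommensurablyTerminal_of_freeFactor_at_cyclicLevel hι b₀ t₀ hℓ hℓS χ₁ hχ₁ χ₂ hχ₂ _ hA₂ bK S
    hS hA

/-- **F-0438 / [CombGC] Prop. 1.2 (ii), first clause, at EVERY irreducible one-nodal datum with cusps**:
at a `PSCDatum` of abc-iut-f-164's irreducible one-nodal shape over a profinite pro-`Σ` completion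
`ι : Γ_{g,r+1} → Π` (`g ≥ 1`; one vertex with a loop; node group `cl ι⟨b_0⟩`, cusp groups `cl ι⟨c_j⟩`,
vertex group `cl ι⟨b_0, a_0 b_0 a_0⁻¹, a_i, b_i (i ≥ 1), c_j⟩`), the verticial and edge-like subgroups are
commensurably terminal: the vertex group by the cyclic-level free-factor engine, the node group as the
closure of the rank-one free factor `⟨b_0⟩` of `Γ`, the cusp groups by abc-iut-L3-t4's
`cuspInertia_closure_isCommensurablyTerminal`; assembled by abc-iut-L5-t6's criterion.
[cite: MochizukiCombGC2007, Prop 1.2(ii) p.8] -/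
theorem verticialEdgeLikeCommensurablyTerminal_of_irreducibleNodal_affine (hne : Sigma.Nonempty)
    (hprime : ∀ p ∈ Sigma, p.Prime) (ι : PuncturedSurfaceGroup g (r + 1) →* P)
    (hι : IsProSigmaCompletion Sigma ι) (G : PSCDatum P) (hg : 1 ≤ g) (e : G.graph.C ≃ Fin (r + 1))
    (hC : ∀ c', G.cuspGp c' = ((cuspInertia (g := g) (e c')).map ι).topologicalClosure)
    (v₀ : G.graph.V) (hV : ∀ w, w = v₀) (n₀ : G.graph.N) (hN : ∀ n, n = n₀)
    (hE : G.nodeGp n₀ = ((Subgroup.zpowers (PuncturedSurfaceGroup.b (r := r + 1) (⟨0, hg⟩ : Fin g))).map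
      ι).topologicalClosure)
    (hV₀ : G.vertGp v₀ = ((Subgroup.closure {x : PuncturedSurfaceGroup g (r + 1) |
        x = PuncturedSurfaceGroup.b ⟨0, hg⟩ ∨
        x = PuncturedSurfaceGroup.a ⟨0, hg⟩ * PuncturedSurfaceGroup.b ⟨0, hg⟩ *
          (PuncturedSurfaceGroup.a ⟨0, hg⟩)⁻¹ ∨
        (∃ i : Fin g, 1 ≤ (i : ℕ) ∧ (x = PuncturedSurfaceGroup.a i ∨ x = PuncturedSurfaceGroup.b i)) ∨
        ∃ j : Fin (r + 1), x = PuncturedSurfaceGroup.c j}).map ι).topologicalClosure) :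
    G.VerticialEdgeLikeCommensurablyTerminal := by
  classical
  have hhyp : PuncturedSurfaceGroup.IsHyperbolicType g (r + 1) := by
    unfold PuncturedSurfaceGroup.IsHyperbolicType; omega
  obtain ⟨ℓ, hℓS⟩ := hne
  have hℓ : ℓ.Prime := hprime ℓ hℓS
  obtain ⟨b₀, -, hbb, -⟩ := exists_freeGroupBasis_elim_zero g r
  refine verticialEdgeLikeCommensurablyTerminal_of G (fun v => ?_) (fun n => ?_) fun c' => ?_
  · rw [hV v, hV₀]
    exact isCommensurablyTerminal_vertGp_of_irreducibleNodal_affine ⟨ℓ, hℓS⟩ hprime ι hι hg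
  · have hform : G.nodeGp n =
        ((Subgroup.closure (b₀ '' {Sum.inl (⟨0, hg⟩, true)})).map ι).topologicalClosure := by
      rw [hN n, hE, Set.image_singleton, hbb, Subgroup.zpowers_eq_closure]
    rw [hform]
    exact freeFactor_isCommensurablyTerminal b₀ _ ⟨_, rfl⟩ hι ⟨ℓ, hℓS, hℓ⟩
  · rw [hC c']
    exact cuspInertia_closure_isCommensurablyTerminal ⟨ℓ, hℓS⟩ hprime hhyp ι hι (e c')

end PSCDatum

end Literature.AnabelianGeometry.SemiGraphs

end
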